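import Literature.NumberTheory.GelbartRogawski1991.LocalSplittingCMThetaCentreDoubling
import Literature.NumberTheory.GelbartRogawski1991.LocalSplittingCMBlockRestrictionRight
import HarnessLib

/-!
# The pin of the L1ns letter as DISJOINTNESS of two rank-one CM type sets: for the plane `T₁ ⊕ᶠ T₂` of two lines at a non-split place,
# `Θ_{s_V}(χ_v∘det) ≠ 0 ⟺ S(s_{−T₁} ∘ toNegForm) ∩ S(s_{T₂}) ≠ ∅`

Topic `NumberTheory/GelbartRogawski1991`; namespace `Literature.NumberTheory.GelbartRogawski1991.UnitaryDualPair.LocalSplitting`.  KERNEL ONLY: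
theorems; no definition, no named fact, no `sorry`, no instance, no notation.  Cell `hodgecm-mathlib` (D-0151), fan B, L1ns road (P) of the crux
hLiu418 — brick E3 = ★ `LocalSplittingCMThetaCentreDoubling` (E1) ∘ ★ `LocalSplittingCMBlockRestrictionRight` (E2) at `n₂ = 1`;
`--supports stmt-HodgeConjecture-24832`, count-neutral.

For two LINES `T₁, T₂ ∈ L⁺ˣ` (the letter's plane `V ⊗ W = (dV₀ a) ⊕ (dV₁ a)`), the second block of E1 — `ω_{T₂} ∘ restrictRight(s_{T₁⊕T₂})` — IS the
rank-one CM package `ω_{T₂} ∘ s_{T₂}` (E2, `1 × 1` matrices are diagonal), so: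

* **`nontrivial_theta_localSplittingCMWith_lines_iff_exists_type_neg`** — at a non-split `v`, with `e′` any open-kernel character of the centre line
  `U(J′)(L⁺_v)` agreeing with `z ↦ ∏_{w ∣ v} χ_w(z_w)` (the letter's `μ_v|_{E_v¹}`):
  `Θ_{s_{T₁⊕T₂}}(e′) ≠ 0 ⟺ ∃ ζ` (open kernel), a type of BOTH `ω_{−T₁} ∘ s_{−T₁} ∘ toNegForm ∘ (z ↦ z)` and `ω_{T₂} ∘ s_{T₂} ∘ (z ↦ z)`;
* **`vanishingCentre_lines_eq_iff_forall_not_type_neg`** — for any `χ₀` satisfying the dichotomy «`Θ(χ′) ≠ 0 ⟺ χ′ ≠ χ₀`» (★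
  `rankOne_theta_anisotropicPlane_dichotomy_centre` when `T₂ = a•T₁`, `(−a⁻¹, d)_v = −1`) and `e′` unitary continuous:
  **`χ₀ = e′ ⟺` the type sets (on open-kernel characters of `E_v¹`) of the rank-one CM packages of the lines `−T₁` (through `toNegForm`) and `T₂`
  are DISJOINT.**
* `…_of_eq` editions of both for a frame `T` given equal to `T₁ ⊕ᶠ T₂` (the consumers' `realDiagonal L dV = (dV₀) ⊕ᶠ (dV₁)`, ★ `realDiagonal_eq_finSum`).

So the L1ns pin (P) «the vanishing centre character of the anisotropic plane is `μ_v|_{E_v¹}`» is EQUIVALENT to the disjointness half of the rank-one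
dichotomy [HarrisKudlaSweet1996, Thm. 6.1 (n = 1)] ∕ [MoeglinVignerasWaldspurger1987, Chap. 3 IV] for the two lines `−T₁ = −dV₀a` and `T₂ = dV₁a`, which
lie in different classes exactly when the plane is anisotropic — the complementarity organ of the LD2 line (★ `LemD1Item4AtV2SeparationOfBlockZeroTrace`
§3 `hsep_of_blockZero_complement`) read on CM line sections.  Neither the disjointness nor the letter is proved here; HC_CM is proved only modulo the
printed citations (2 remaining named inputs hLiu418, h413) until rung 0 closes.

## References
* [Kudla1994] S. Kudla, Israel J. Math. 87 (1994), §3 Thm. 3.1.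
* [HarrisKudlaSweet1996] M. Harris, S. Kudla, W. Sweet, J. AMS 9 (1996), §6 Thm. 6.1.
* [MoeglinVignerasWaldspurger1987] C. Mœglin, M.-F. Vignéras, J.-L. Waldspurger, LNM 1291 (1987), Chap. 2 II.1 Rem. (6); Chap. 3 IV.4.
* [Liu2021] Y. Liu, Camb. J. Math. 9 (2021), App. D Lemma D.1 (1).
-/

set_option autoImplicit false

noncomputable section

open scoped Matrix
open NumberField IsDedekindDomain MeasureTheory Matrix
open Literature.RepresentationTheory Literature.RepresentationTheory.HeisenbergGroup
open Literature.RepresentationTheory.TwistedCoinv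
open Literature.RepresentationTheory.MoeglinVignerasWaldspurger1987
open Literature.NumberTheory.Automorphic Literature.NumberTheory.Automorphic.UnitaryGroup Literature.NumberTheory.Weil1964
open Literature.NumberTheory.GaloisRepresentations Literature.RepresentationTheory.HarrisKudlaSweet1996

namespace Literature.NumberTheory.GelbartRogawski1991.UnitaryDualPair.LocalSplitting

variable (L : Type) [Field L] [NumberField L] [IsCMField L] (v : HeightOneSpectrum (𝓞 (maximalRealSubfield L)))
  [MeasurableSpace (v.adicCompletion (maximalRealSubfield L))] [BorelSpace (v.adicCompletion (maximalRealSubfield L))]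
  (μ : Measure (v.adicCompletion (maximalRealSubfield L))) [μ.IsAddHaarMeasure]
  {T₁ T₂ : Matrix (Fin 1) (Fin 1) (maximalRealSubfield L)}

/-- a `1 × 1` matrix is diagonal. [folklore] -/
private theorem eq_diagonal_fin_one' {R : Type*} [Zero R] (M : Matrix (Fin 1) (Fin 1) R) : M = Matrix.diagonal fun _ => M 0 0 := by
  ext i j
  obtain rfl : i = 0 := Subsingleton.elim _ _
  obtain rfl : j = 0 := Subsingleton.elim _ _
  rw [Matrix.diagonal_apply_eq]

set_option synthInstance.maxHeartbeats 400000 in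
set_option maxHeartbeats 4000000 in -- block-currency terms
/-- **`Θ_{s_{T₁⊕T₂}}(χ_v∘det) ≠ 0 ⟺ S(s_{−T₁} ∘ toNegForm) ∩ S(s_{T₂}) ≠ ∅`** for two lines `T₁, T₂` at a non-split place (E1 with the second block
identified by E2). [cite: Kudla1994, §3 Thm. 3.1] [cite: HarrisKudlaSweet1996, §6] [cite: MoeglinVignerasWaldspurger1987, Chap. 2 II.1 Rem. (6)] -/
theorem nontrivial_theta_localSplittingCMWith_lines_iff_exists_type_neg (hE : IsField (UnitaryGroup.LocalRing L v))
    (hT₁ : T₁.IsSymm) (hT₂ : T₂.IsSymm) (hT₁d : IsUnit T₁.det) (hT₂d : IsUnit T₂.det)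
    {J₁ : Matrix (Fin 1) (Fin 1) L} (hJ₁ : J₁ = T₁.map (algebraMap (maximalRealSubfield L) L))
    {J₁' : Matrix (Fin 1) (Fin 1) L} (hJ₁' : J₁' = (-T₁).map (algebraMap (maximalRealSubfield L) L))
    {J₂ : Matrix (Fin 1) (Fin 1) L} (hJ₂ : J₂ = T₂.map (algebraMap (maximalRealSubfield L) L))
    {J : Matrix (Fin (1 + 1)) (Fin (1 + 1)) L}
    (hJ : J = (UnitaryGroup.finSum 1 1 T₁ T₂).map (algebraMap (maximalRealSubfield L) L))
    (χ : HeckeCharacter L) (hχ : IsSplittingChar L 1 χ) {J' : Matrix (Fin 1) (Fin 1) L} (hJ'0 : J' 0 0 ≠ 0)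
    (e' : localPi L (IsCMField.complexConj L) 1 J' v →* ℂˣ) (he'o : IsOpen (e'.ker : Set (localPi L (IsCMField.complexConj L) 1 J' v)))
    (he' : ∀ z, e' z = ∏ w' : PlacesOver L v, χ.localComponent w'.1 (Matrix.GeneralLinearGroup.det
      (((UnitaryGroup.localCenter L (IsCMField.complexConj L) 1 J₁ J' hJ'0 v z : localPi L (IsCMField.complexConj L) 1 J₁ v) :
        LocalGLPi L 1 v) w'))) :
    Nontrivial (Coinv ((((MpPsi.toRep (localSchrodinger (maximalRealSubfield L) (1 + 1) (UnitaryGroup.finSum 1 1 T₁ T₂) v)).comp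
        (localSplittingCMWith L (1 + 1) (UnitaryGroup.isSymm_finSum hT₁ hT₂) (DoubledBlock.isUnit_det_finSum L 1 1 hT₁d hT₂d) hJ χ hχ v μ))).comp
        (UnitaryGroup.localCenter L (IsCMField.complexConj L) (1 + 1) J J' hJ'0 v)) e') ↔
      ∃ ζ : localPi L (IsCMField.complexConj L) 1 J' v →* ℂˣ, IsOpen (ζ.ker : Set (localPi L (IsCMField.complexConj L) 1 J' v)) ∧
        Nontrivial (Coinv ((((MpPsi.toRep (localSchrodinger (maximalRealSubfield L) 1 (-T₁) v)).comp
          (localSplittingCMWith L 1 hT₁.neg (isUnit_det_neg_of_isUnit (maximalRealSubfield L) 1 hT₁d) hJ₁' χ hχ v μ))).comp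
          ((toNegForm (maximalRealSubfield L) L (IsCMField.complexConj L) v 1 hJ₁ hJ₁').toMonoidHom.comp
            (UnitaryGroup.localCenter L (IsCMField.complexConj L) 1 J₁ J' hJ'0 v))) ζ) ∧
        Nontrivial (Coinv ((((MpPsi.toRep (localSchrodinger (maximalRealSubfield L) 1 T₂ v)).comp
          (localSplittingCMWith L 1 hT₂ hT₂d hJ₂ χ hχ v μ))).comp
          (UnitaryGroup.localCenter L (IsCMField.complexConj L) 1 J₂ J' hJ'0 v)) ζ) := by
  have h := nontrivial_theta_localSplittingCMWith_iff_exists_type_neg L v μ 1 hE hT₁ hT₂ hT₁d hT₂d hJ₁ hJ₁' hJ₂ hJ χ hχ hJ'0 e' he'o he'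
  rw [restrictRight_localSplittingCMWith L v μ 1 Nat.one_pos (fun _ => T₁ 0 0) (fun _ => T₂ 0 0) (eq_diagonal_fin_one' T₁)
    (eq_diagonal_fin_one' T₂) hT₁ hT₂ hT₁d hT₂d hJ₂ hJ χ hχ] at h
  exact h

set_option synthInstance.maxHeartbeats 400000 in
set_option maxHeartbeats 4000000 in -- block-currency terms
/-- **THE L1ns PIN AS RANK-ONE DISJOINTNESS.**  For two lines `T₁, T₂` at a non-split `v`, `e′` unitary continuous with open kernel agreeing with
`z ↦ ∏_w χ_w(z_w)`, and `χ₀` any character satisfying the dichotomy «`Θ_{s_{T₁⊕T₂}}(χ′) ≠ 0 ⟺ χ′ ≠ χ₀`» for unitary continuous `χ′`: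
**`χ₀ = e′ ⟺ ∀ ζ` (open kernel), `ζ ∈ S(ω_{−T₁} ∘ s_{−T₁} ∘ toNegForm ∘ (z ↦ z)) → ζ ∉ S(ω_{T₂} ∘ s_{T₂} ∘ (z ↦ z))`.**
[cite: Kudla1994, §3 Thm. 3.1] [cite: HarrisKudlaSweet1996, §6 Thm. 6.1] [cite: MoeglinVignerasWaldspurger1987, Chap. 3 IV.4] [cite: Liu2021, App. D Lemma D.1 (1)] -/
theorem vanishingCentre_lines_eq_iff_forall_not_type_neg (hE : IsField (UnitaryGroup.LocalRing L v))
    (hT₁ : T₁.IsSymm) (hT₂ : T₂.IsSymm) (hT₁d : IsUnit T₁.det) (hT₂d : IsUnit T₂.det)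
    {J₁ : Matrix (Fin 1) (Fin 1) L} (hJ₁ : J₁ = T₁.map (algebraMap (maximalRealSubfield L) L))
    {J₁' : Matrix (Fin 1) (Fin 1) L} (hJ₁' : J₁' = (-T₁).map (algebraMap (maximalRealSubfield L) L))
    {J₂ : Matrix (Fin 1) (Fin 1) L} (hJ₂ : J₂ = T₂.map (algebraMap (maximalRealSubfield L) L))
    {J : Matrix (Fin (1 + 1)) (Fin (1 + 1)) L}
    (hJ : J = (UnitaryGroup.finSum 1 1 T₁ T₂).map (algebraMap (maximalRealSubfield L) L))
    (χ : HeckeCharacter L) (hχ : IsSplittingChar L 1 χ) {J' : Matrix (Fin 1) (Fin 1) L} (hJ'0 : J' 0 0 ≠ 0)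
    (e' : localPi L (IsCMField.complexConj L) 1 J' v →* ℂˣ) (he'o : IsOpen (e'.ker : Set (localPi L (IsCMField.complexConj L) 1 J' v)))
    (he' : ∀ z, e' z = ∏ w' : PlacesOver L v, χ.localComponent w'.1 (Matrix.GeneralLinearGroup.det
      (((UnitaryGroup.localCenter L (IsCMField.complexConj L) 1 J₁ J' hJ'0 v z : localPi L (IsCMField.complexConj L) 1 J₁ v) :
        LocalGLPi L 1 v) w')))
    (he'u : ∀ u, ‖((e' u : ℂˣ) : ℂ)‖ = 1) (he'c : Continuous fun u => ((e' u : ℂˣ) : ℂ))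
    (χ₀ : localPi L (IsCMField.complexConj L) 1 J' v →* ℂˣ)
    (hdich : ∀ χ' : localPi L (IsCMField.complexConj L) 1 J' v →* ℂˣ, (∀ u, ‖((χ' u : ℂˣ) : ℂ)‖ = 1) →
      (Continuous fun u => ((χ' u : ℂˣ) : ℂ)) →
      (Nontrivial (Coinv ((((MpPsi.toRep (localSchrodinger (maximalRealSubfield L) (1 + 1) (UnitaryGroup.finSum 1 1 T₁ T₂) v)).comp
        (localSplittingCMWith L (1 + 1) (UnitaryGroup.isSymm_finSum hT₁ hT₂) (DoubledBlock.isUnit_det_finSum L 1 1 hT₁d hT₂d) hJ χ hχ v μ))).comp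
        (UnitaryGroup.localCenter L (IsCMField.complexConj L) (1 + 1) J J' hJ'0 v)) χ') ↔ χ' ≠ χ₀)) :
    χ₀ = e' ↔
      ∀ ζ : localPi L (IsCMField.complexConj L) 1 J' v →* ℂˣ, IsOpen (ζ.ker : Set (localPi L (IsCMField.complexConj L) 1 J' v)) →
        Nontrivial (Coinv ((((MpPsi.toRep (localSchrodinger (maximalRealSubfield L) 1 (-T₁) v)).comp
          (localSplittingCMWith L 1 hT₁.neg (isUnit_det_neg_of_isUnit (maximalRealSubfield L) 1 hT₁d) hJ₁' χ hχ v μ))).comp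
          ((toNegForm (maximalRealSubfield L) L (IsCMField.complexConj L) v 1 hJ₁ hJ₁').toMonoidHom.comp
            (UnitaryGroup.localCenter L (IsCMField.complexConj L) 1 J₁ J' hJ'0 v))) ζ) →
        ¬ Nontrivial (Coinv ((((MpPsi.toRep (localSchrodinger (maximalRealSubfield L) 1 T₂ v)).comp
          (localSplittingCMWith L 1 hT₂ hT₂d hJ₂ χ hχ v μ))).comp
          (UnitaryGroup.localCenter L (IsCMField.complexConj L) 1 J₂ J' hJ'0 v)) ζ) := by
  have h := vanishingCentre_eq_iff_forall_not_type_neg L v μ 1 hE hT₁ hT₂ hT₁d hT₂d hJ₁ hJ₁' hJ₂ hJ χ hχ hJ'0 e' he'o he' he'u he'c χ₀ hdich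
  rw [restrictRight_localSplittingCMWith L v μ 1 Nat.one_pos (fun _ => T₁ 0 0) (fun _ => T₂ 0 0) (eq_diagonal_fin_one' T₁)
    (eq_diagonal_fin_one' T₂) hT₁ hT₂ hT₁d hT₂d hJ₂ hJ χ hχ] at h
  exact h


set_option synthInstance.maxHeartbeats 400000 in
set_option maxHeartbeats 4000000 in -- block-currency terms
/-- **Edition 2 (`_of_eq`): the same for a frame `T` GIVEN EQUAL to `T₁ ⊕ᶠ T₂`** (`hT : T = finSum 1 1 T₁ T₂`, the consumer's `s_V = localSplittingCMWith … T …`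
typed over `T` with its own symmetry ∕ determinant witnesses; cf. ★ `rankOne_theta_anisotropicPlane_dichotomy_of_eq`, ★ `realDiagonal_eq_finSum`).
[cite: Kudla1994, §3 Thm. 3.1] [cite: HarrisKudlaSweet1996, §6] [cite: MoeglinVignerasWaldspurger1987, Chap. 2 II.1 Rem. (6)] -/
theorem nontrivial_theta_localSplittingCMWith_lines_iff_exists_type_neg_of_eq (hE : IsField (UnitaryGroup.LocalRing L v))
    (hT₁ : T₁.IsSymm) (hT₂ : T₂.IsSymm) (hT₁d : IsUnit T₁.det) (hT₂d : IsUnit T₂.det)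
    {T : Matrix (Fin (1 + 1)) (Fin (1 + 1)) (maximalRealSubfield L)} (hT : T = UnitaryGroup.finSum 1 1 T₁ T₂) (hTs : T.IsSymm) (hTd : IsUnit T.det)
    {J₁ : Matrix (Fin 1) (Fin 1) L} (hJ₁ : J₁ = T₁.map (algebraMap (maximalRealSubfield L) L))
    {J₁' : Matrix (Fin 1) (Fin 1) L} (hJ₁' : J₁' = (-T₁).map (algebraMap (maximalRealSubfield L) L))
    {J₂ : Matrix (Fin 1) (Fin 1) L} (hJ₂ : J₂ = T₂.map (algebraMap (maximalRealSubfield L) L))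
    {J : Matrix (Fin (1 + 1)) (Fin (1 + 1)) L} (hJ : J = T.map (algebraMap (maximalRealSubfield L) L))
    (χ : HeckeCharacter L) (hχ : IsSplittingChar L 1 χ) {J' : Matrix (Fin 1) (Fin 1) L} (hJ'0 : J' 0 0 ≠ 0)
    (e' : localPi L (IsCMField.complexConj L) 1 J' v →* ℂˣ) (he'o : IsOpen (e'.ker : Set (localPi L (IsCMField.complexConj L) 1 J' v)))
    (he' : ∀ z, e' z = ∏ w' : PlacesOver L v, χ.localComponent w'.1 (Matrix.GeneralLinearGroup.det
      (((UnitaryGroup.localCenter L (IsCMField.complexConj L) 1 J₁ J' hJ'0 v z : localPi L (IsCMField.complexConj L) 1 J₁ v) :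
        LocalGLPi L 1 v) w'))) :
    Nontrivial (Coinv ((((MpPsi.toRep (localSchrodinger (maximalRealSubfield L) (1 + 1) T v)).comp
        (localSplittingCMWith L (1 + 1) hTs hTd hJ χ hχ v μ))).comp
        (UnitaryGroup.localCenter L (IsCMField.complexConj L) (1 + 1) J J' hJ'0 v)) e') ↔
      ∃ ζ : localPi L (IsCMField.complexConj L) 1 J' v →* ℂˣ, IsOpen (ζ.ker : Set (localPi L (IsCMField.complexConj L) 1 J' v)) ∧
        Nontrivial (Coinv ((((MpPsi.toRep (localSchrodinger (maximalRealSubfield L) 1 (-T₁) v)).comp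
          (localSplittingCMWith L 1 hT₁.neg (isUnit_det_neg_of_isUnit (maximalRealSubfield L) 1 hT₁d) hJ₁' χ hχ v μ))).comp
          ((toNegForm (maximalRealSubfield L) L (IsCMField.complexConj L) v 1 hJ₁ hJ₁').toMonoidHom.comp
            (UnitaryGroup.localCenter L (IsCMField.complexConj L) 1 J₁ J' hJ'0 v))) ζ) ∧
        Nontrivial (Coinv ((((MpPsi.toRep (localSchrodinger (maximalRealSubfield L) 1 T₂ v)).comp
          (localSplittingCMWith L 1 hT₂ hT₂d hJ₂ χ hχ v μ))).comp
          (UnitaryGroup.localCenter L (IsCMField.complexConj L) 1 J₂ J' hJ'0 v)) ζ) := by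
  subst hT
  exact nontrivial_theta_localSplittingCMWith_lines_iff_exists_type_neg L v μ hE hT₁ hT₂ hT₁d hT₂d hJ₁ hJ₁' hJ₂ hJ χ hχ hJ'0 e' he'o he'

set_option synthInstance.maxHeartbeats 400000 in
set_option maxHeartbeats 4000000 in -- block-currency terms
/-- **Edition 2 (`_of_eq`) of the pin-as-disjointness statement** for a frame `T` given equal to `T₁ ⊕ᶠ T₂`.
[cite: Kudla1994, §3 Thm. 3.1] [cite: HarrisKudlaSweet1996, §6 Thm. 6.1] [cite: MoeglinVignerasWaldspurger1987, Chap. 3 IV.4] [cite: Liu2021, App. D Lemma D.1 (1)] -/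
theorem vanishingCentre_lines_eq_iff_forall_not_type_neg_of_eq (hE : IsField (UnitaryGroup.LocalRing L v))
    (hT₁ : T₁.IsSymm) (hT₂ : T₂.IsSymm) (hT₁d : IsUnit T₁.det) (hT₂d : IsUnit T₂.det)
    {T : Matrix (Fin (1 + 1)) (Fin (1 + 1)) (maximalRealSubfield L)} (hT : T = UnitaryGroup.finSum 1 1 T₁ T₂) (hTs : T.IsSymm) (hTd : IsUnit T.det)
    {J₁ : Matrix (Fin 1) (Fin 1) L} (hJ₁ : J₁ = T₁.map (algebraMap (maximalRealSubfield L) L))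
    {J₁' : Matrix (Fin 1) (Fin 1) L} (hJ₁' : J₁' = (-T₁).map (algebraMap (maximalRealSubfield L) L))
    {J₂ : Matrix (Fin 1) (Fin 1) L} (hJ₂ : J₂ = T₂.map (algebraMap (maximalRealSubfield L) L))
    {J : Matrix (Fin (1 + 1)) (Fin (1 + 1)) L} (hJ : J = T.map (algebraMap (maximalRealSubfield L) L))
    (χ : HeckeCharacter L) (hχ : IsSplittingChar L 1 χ) {J' : Matrix (Fin 1) (Fin 1) L} (hJ'0 : J' 0 0 ≠ 0)
    (e' : localPi L (IsCMField.complexConj L) 1 J' v →* ℂˣ) (he'o : IsOpen (e'.ker : Set (localPi L (IsCMField.complexConj L) 1 J' v)))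
    (he' : ∀ z, e' z = ∏ w' : PlacesOver L v, χ.localComponent w'.1 (Matrix.GeneralLinearGroup.det
      (((UnitaryGroup.localCenter L (IsCMField.complexConj L) 1 J₁ J' hJ'0 v z : localPi L (IsCMField.complexConj L) 1 J₁ v) :
        LocalGLPi L 1 v) w')))
    (he'u : ∀ u, ‖((e' u : ℂˣ) : ℂ)‖ = 1) (he'c : Continuous fun u => ((e' u : ℂˣ) : ℂ))
    (χ₀ : localPi L (IsCMField.complexConj L) 1 J' v →* ℂˣ)
    (hdich : ∀ χ' : localPi L (IsCMField.complexConj L) 1 J' v →* ℂˣ, (∀ u, ‖((χ' u : ℂˣ) : ℂ)‖ = 1) →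
      (Continuous fun u => ((χ' u : ℂˣ) : ℂ)) →
      (Nontrivial (Coinv ((((MpPsi.toRep (localSchrodinger (maximalRealSubfield L) (1 + 1) T v)).comp
        (localSplittingCMWith L (1 + 1) hTs hTd hJ χ hχ v μ))).comp
        (UnitaryGroup.localCenter L (IsCMField.complexConj L) (1 + 1) J J' hJ'0 v)) χ') ↔ χ' ≠ χ₀)) :
    χ₀ = e' ↔
      ∀ ζ : localPi L (IsCMField.complexConj L) 1 J' v →* ℂˣ, IsOpen (ζ.ker : Set (localPi L (IsCMField.complexConj L) 1 J' v)) →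
        Nontrivial (Coinv ((((MpPsi.toRep (localSchrodinger (maximalRealSubfield L) 1 (-T₁) v)).comp
          (localSplittingCMWith L 1 hT₁.neg (isUnit_det_neg_of_isUnit (maximalRealSubfield L) 1 hT₁d) hJ₁' χ hχ v μ))).comp
          ((toNegForm (maximalRealSubfield L) L (IsCMField.complexConj L) v 1 hJ₁ hJ₁').toMonoidHom.comp
            (UnitaryGroup.localCenter L (IsCMField.complexConj L) 1 J₁ J' hJ'0 v))) ζ) →
        ¬ Nontrivial (Coinv ((((MpPsi.toRep (localSchrodinger (maximalRealSubfield L) 1 T₂ v)).comp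
          (localSplittingCMWith L 1 hT₂ hT₂d hJ₂ χ hχ v μ))).comp
          (UnitaryGroup.localCenter L (IsCMField.complexConj L) 1 J₂ J' hJ'0 v)) ζ) := by
  subst hT
  exact vanishingCentre_lines_eq_iff_forall_not_type_neg L v μ hE hT₁ hT₂ hT₁d hT₂d hJ₁ hJ₁' hJ₂ hJ χ hχ hJ'0 e' he'o he' he'u he'c χ₀ hdich

end Literature.NumberTheory.GelbartRogawski1991.UnitaryDualPair.LocalSplitting

end
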